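import Summits.Ventures.HodgeRepro2.Defs

/-! # HodgeRepro2 — dictionary hermitian ↔ skew-hermitian, irregularity, Dimitrov–Ramakrishnan levels

Blind re-derivation cell `pub-hodge-repro2`, seat p1 (second definitions file; `Defs.lean` holds the [Sh79] data
and Theorem 8.1).  Sources, read as printed through the literature tools:

* [Sh79] G. Shimura, J. Math. Soc. Japan 31 (1979) 561–592, §3–§4, §8.
* [DR15] M. Dimitrov, D. Ramakrishnan, *Arithmetic quotients of the complex ball and a conjecture of Lang*,
  Doc. Math. 20 (2015), 1185–1205 (arXiv:1401.1628): p. 1 (the group `G = U(h)` for a hermitian form `h` on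
  `M^{n+1}` of signature `(n,1)` at one infinite place `ι` and `(n+1,0)` or `(0,n+1)` at the others),
  Definition 1.3 (`Γ(𝔑), Γ_0(𝔑), Γ_1(𝔑)`), §2 (`q(Y_Γ) = dim H⁰(Ω¹)`), §2.2 (non-vanishing of `q(Y_Γ)` for small
  congruence subgroups "by a theorem of Shimura [JMSJ 31 (1979)]").

Contents: §6 the dictionary `T = δ h` between [DR15]'s hermitian and [Sh79]'s skew-hermitian conventions, the CM
type `Φ_δ` cut out by a purely imaginary `δ`, the sign bookkeeping (`IsAdaptedImaginary`) and the dictionary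
statement; §7 the space of invariant closed holomorphic 1-forms, the irregularity, and the (proved) linear
independence of `ξ_1, …, ξ_r` when `ξ_1 ∧ ⋯ ∧ ξ_r ≠ 0`; §8 the congruence subgroups of [DR15] Def. 1.3 inside
`GL_m(𝓞 K)`.  Deliberately NOT here: adelic Hecke characters, Arthur packets, root numbers ([DR15] §3). -/

namespace Summit.Ventures.HodgeRepro2

open Matrix NumberField
open scoped ComplexOrder

/-! ## 6. Dictionary: hermitian form (Dimitrov–Ramakrishnan) ↔ skew-hermitian `T` (Shimura) -/

section Dictionary

variable (K : Type*) [Field K] [NumberField K] [IsCMField K]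
variable {m : ℕ}

/-- Signature frame for an arbitrary complex matrix `H` (not only `-i T^τ`): `H = Q^ρ J_{r,s} ᵗQ`, [Sh79] (4.2). -/
def IsSignatureFrameOf (H : Matrix (Fin m) (Fin m) ℂ) (r : ℕ) (Q : GL (Fin m) ℂ) : Prop :=
  H = (Q : Matrix (Fin m) (Fin m) ℂ).map (starRingEnd ℂ) * Jrs m r * (Q : Matrix (Fin m) (Fin m) ℂ)ᵀ

/-- `H` has signature `(r, m - r)`. -/
def HasSignatureOf (H : Matrix (Fin m) (Fin m) ℂ) (r : ℕ) : Prop :=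
  ∃ Q : GL (Fin m) ℂ, IsSignatureFrameOf H r Q

omit [NumberField K] [IsCMField K] in
/-- `IsSignatureFrame K T τ r Q` is the special case `H = -i T^τ` of `IsSignatureFrameOf`. -/
theorem isSignatureFrame_iff (T : Matrix (Fin m) (Fin m) K) (τ : K →+* ℂ) (r : ℕ) (Q : GL (Fin m) ℂ) :
    IsSignatureFrame K T τ r Q ↔ IsSignatureFrameOf ((-Complex.I) • T.map τ) r Q :=
  Iff.rfl

/-- [DR15] p. 1 writes the unitary group through a HERMITIAN form `h`; [Sh79] §4 through a SKEW-hermitian `T`.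
For `δ ∈ K` purely imaginary (`δ^ρ = -δ`) the two are exchanged by `T = δ h`. -/
def hermitianToSkew (δ : K) (h : Matrix (Fin m) (Fin m) K) : Matrix (Fin m) (Fin m) K := δ • h

/-- `T = δ h` is skew-hermitian when `h` is hermitian and `δ^ρ = -δ`. -/
theorem isSkewHermitian_hermitianToSkew {δ : K} (hδ : star δ = -δ) {h : Matrix (Fin m) (Fin m) K}
    (hh : h.IsHermitian) : IsSkewHermitian K (hermitianToSkew K δ h) := by
  unfold IsSkewHermitian hermitianToSkew
  rw [conjTranspose_smul, hh.eq, hδ, neg_smul]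

/-- The CM type cut out by a purely imaginary `δ`: the embeddings `τ` with `-i τ(δ) > 0`.  For `T = δ h` with
`h` hermitian this is the set of `τ` at which `-i T^τ` and `h^τ` have the SAME signature (the others give the
opposite signature); it is the CM type `{τ_1, …, τ_g}` of [Sh79] §4 attached to the polarisation `T`. -/
def cmTypeOfImaginary (δ : K) : Set (K →+* ℂ) := {τ | 0 < (-Complex.I * τ δ).re}

/-- For `δ ≠ 0` purely imaginary, `cmTypeOfImaginary K δ` is a CM type of `K`. -/
theorem isCMType_cmTypeOfImaginary {δ : K} (hδ : star δ = -δ) (h0 : δ ≠ 0) :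
    IsCMType K (cmTypeOfImaginary K δ) := by
  intro τ
  have hconj : (starRingEnd ℂ) (τ δ) = -τ δ := by
    have := NumberField.IsCMField.complexEmbedding_complexConj K τ δ
    rw [show NumberField.IsCMField.complexConj K δ = star δ from rfl, hδ, map_neg] at this
    exact this.symm
  have hre : (τ δ).re = 0 := by
    have := congrArg Complex.re hconj
    simp only [Complex.conj_re, Complex.neg_re] at this
    linarith
  have hne : (τ δ).im ≠ 0 := by
    intro him
    apply h0
    apply τ.injective
    rw [map_zero]
    exact Complex.ext hre him
  have e1 : (-Complex.I * τ δ).re = (τ δ).im := by simp [Complex.mul_re]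
  have e2 : (-Complex.I * (ComplexEmbedding.conjugate τ) δ).re = -(τ δ).im := by
    rw [ComplexEmbedding.conjugate_coe_eq, hconj]
    simp [Complex.mul_re]
  simp only [cmTypeOfImaginary, Set.mem_setOf_eq, e1, e2]
  rcases lt_or_gt_of_ne hne with h | h
  · exact Or.inr ⟨by linarith, by linarith⟩
  · exact Or.inl ⟨h, by linarith⟩

/-- [DR15] p. 1, the hermitian datum: `h` a hermitian form on `K^{n+1}` (here `K` plays the role of `M`, `K⁺` of
`F`), of signature `(n,1)` at the distinguished embedding `ι` and definite (`(n+1,0)` or `(0,n+1)`) at every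
embedding not lying over the real place `ι|_{K⁺}` (i.e. `τ ∉ {ι, ῑ}`). -/
structure DRHermitianData (n : ℕ) where
  /-- the hermitian matrix `h` -/
  h : Matrix (Fin (n + 1)) (Fin (n + 1)) K
  /-- `h` is hermitian -/
  herm : h.IsHermitian
  /-- the distinguished embedding `ι` (signature `(n,1)` there) -/
  ι : K →+* ℂ
  /-- `h^ι` has signature `(n, 1)` -/
  sig : HasSignatureOf (h.map ι) n
  /-- `h^τ` is definite for `τ ∉ {ι, ῑ}` -/
  definite : ∀ τ : K →+* ℂ, τ ≠ ι → τ ≠ ComplexEmbedding.conjugate ι →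
    (h.map τ).PosDef ∨ (-(h.map τ)).PosDef

/-- A purely imaginary `δ ≠ 0` is *adapted* to the hermitian datum `(h, ι)` if `-i ι(δ) > 0` and `h^τ` is
POSITIVE definite at every other member `τ` of the CM type `Φ_δ = cmTypeOfImaginary K δ`.  This is the sign
bookkeeping that turns a [DR15] datum into a [Sh79] §4 datum `(T = δ h, Φ_δ, τ_1 = ι)` with
`(r_1, s_1) = (n, 1)` and `s_ν = 0` for `ν ≥ 2`; replacing `δ` by `f δ` with `f ∈ K⁺` of prescribed signs at the
real places moves `τ` to `ῑ`-type members and flips `(n+1,0)` to `(0,n+1)`. -/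
def IsAdaptedImaginary {n : ℕ} (D : DRHermitianData K n) (δ : K) : Prop :=
  star δ = -δ ∧ δ ≠ 0 ∧ 0 < (-Complex.I * D.ι δ).re ∧
    ∀ τ ∈ cmTypeOfImaginary K δ, τ ≠ D.ι → (D.h.map τ).PosDef

/-- The dictionary as a statement: every [DR15] hermitian datum with an adapted `δ` yields a [Sh79] Theorem 8.1
datum with `T = δ h`, CM type `Φ_δ`, distinguished embedding `τ_1 = ι`, and ANY full lattice `𝔪`. -/
def HermitianToShimuraDictionary (n : ℕ) : Prop :=
  ∀ (D : DRHermitianData K n) (δ : K), IsAdaptedImaginary K D δ →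
    ∀ 𝔪 : Submodule ℤ (Fin (n + 1) → K), IsFullLattice K 𝔪 →
      ∃ S : Thm81Data K n, S.T = hermitianToSkew K δ D.h ∧ S.Φ = cmTypeOfImaginary K δ ∧ S.τ = D.ι ∧ S.𝔪 = 𝔪

end Dictionary

/-! ## 9. The dictionary, proved; the conjugate datum (`τ_1 ↦ τ̄_1`, `T ↦ -T`, `Q_1 ↦ Q̄_1`) -/

section DictionaryProof

variable (K : Type*) [Field K] [NumberField K] [IsCMField K]

/-- For `δ^ρ = -δ`, every complex embedding sends `δ` to a purely imaginary number. -/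
theorem re_eq_zero_of_star_eq_neg {δ : K} (hδ : star δ = -δ) (τ : K →+* ℂ) : (τ δ).re = 0 := by
  have hconj : (starRingEnd ℂ) (τ δ) = -τ δ := by
    have := NumberField.IsCMField.complexEmbedding_complexConj K τ δ
    rw [show NumberField.IsCMField.complexConj K δ = star δ from rfl, hδ, map_neg] at this
    exact this.symm
  have := congrArg Complex.re hconj
  simp only [Complex.conj_re, Complex.neg_re] at this
  linarith

/-- `-i τ(δ)` is real when `δ^ρ = -δ`. -/
theorem negI_mul_im_eq_zero {δ : K} (hδ : star δ = -δ) (τ : K →+* ℂ) : (-Complex.I * τ δ).im = 0 := by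
  have := re_eq_zero_of_star_eq_neg K hδ τ
  simp [Complex.mul_im, this]

/-- `0 < -i τ(δ)` (complex order) iff `τ ∈ Φ_δ`. -/
theorem zero_lt_negI_mul_iff {δ : K} (hδ : star δ = -δ) (τ : K →+* ℂ) :
    (0 : ℂ) < -Complex.I * τ δ ↔ τ ∈ cmTypeOfImaginary K δ := by
  rw [Complex.lt_def, negI_mul_im_eq_zero K hδ τ]
  simp [cmTypeOfImaginary]

omit [NumberField K] [IsCMField K] in
/-- `(-i) (δ h)^τ = (-i τ(δ)) • h^τ`. -/
theorem negI_smul_map_hermitianToSkew {m : ℕ} (δ : K) (h : Matrix (Fin m) (Fin m) K) (τ : K →+* ℂ) :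
    (-Complex.I) • (hermitianToSkew K δ h).map τ = (-Complex.I * τ δ) • h.map τ := by
  unfold hermitianToSkew
  rw [Matrix.map_smul' τ δ h (map_mul τ), smul_smul]

/-- The scalar unit `√c · 1_m ∈ GL_m(ℂ)` for a real `c > 0`. -/
noncomputable def sqrtScalarGL (m : ℕ) {c : ℝ} (hc : 0 < c) : GL (Fin m) ℂ :=
  Matrix.GeneralLinearGroup.scalar (Fin m)
    (Units.mk0 ((Real.sqrt c : ℝ) : ℂ) (Complex.ofReal_ne_zero.2 (Real.sqrt_pos.2 hc).ne'))

/-- Scaling a frame: if `H = Q̄ J ᵗQ` and `c > 0` is real, then `c • H = Q'̄ J ᵗQ'` with `Q' = √c • Q`. -/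
theorem isSignatureFrameOf_smul {m : ℕ} {H : Matrix (Fin m) (Fin m) ℂ} {r : ℕ} {Q : GL (Fin m) ℂ}
    (hQ : IsSignatureFrameOf H r Q) {c : ℝ} (hc : 0 < c) :
    IsSignatureFrameOf ((c : ℂ) • H) r (sqrtScalarGL m hc * Q) := by
  unfold IsSignatureFrameOf at hQ ⊢
  set s : ℂ := ((Real.sqrt c : ℝ) : ℂ) with hs
  have hQ' : ((sqrtScalarGL m hc * Q : GL (Fin m) ℂ) : Matrix (Fin m) (Fin m) ℂ) =
      s • (Q : Matrix (Fin m) (Fin m) ℂ) := by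
    rw [Units.val_mul, sqrtScalarGL, Matrix.GeneralLinearGroup.coe_scalar, Units.val_mk0,
      Matrix.scalar_apply, ← smul_eq_diagonal_mul]
  rw [hQ', Matrix.map_smul' (starRingEnd ℂ) s _ (map_mul _), hs, Complex.conj_ofReal, transpose_smul,
    Matrix.smul_mul, Matrix.mul_smul, Matrix.smul_mul, smul_smul, ← hQ, ← Complex.ofReal_mul,
    Real.mul_self_sqrt hc.le]

/-- The dictionary holds: every [DR15] hermitian datum `(h, ι)` with an adapted purely imaginary `δ` gives a
[Sh79] Theorem 8.1 datum `(T = δ h, Φ_δ, τ_1 = ι, Q_1 = √(-i ι(δ)) Q_0, 𝔪)`. -/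
theorem hermitianToShimuraDictionary_holds (n : ℕ) : HermitianToShimuraDictionary K n := by
  intro D δ hδ 𝔪 h𝔪
  obtain ⟨hstar, h0, hι, hpos⟩ := hδ
  obtain ⟨Q₀, hQ₀⟩ := D.sig
  have hcim : (-Complex.I * D.ι δ).im = 0 := negI_mul_im_eq_zero K hstar D.ι
  have hcval : (-Complex.I * D.ι δ) = (((-Complex.I * D.ι δ).re : ℝ) : ℂ) := by
    refine Complex.ext ?_ ?_
    · simp
    · rw [Complex.ofReal_im, hcim]
  have key : IsSignatureFrameOf ((((-Complex.I * D.ι δ).re : ℝ) : ℂ) • D.h.map D.ι) n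
      (sqrtScalarGL (n + 1) hι * Q₀) := isSignatureFrameOf_smul hQ₀ hι
  rw [← hcval] at key
  refine ⟨{ T := hermitianToSkew K δ D.h
            skew := isSkewHermitian_hermitianToSkew K hstar D.herm
            Φ := cmTypeOfImaginary K δ
            cmtype := isCMType_cmTypeOfImaginary K hstar h0
            τ := D.ι
            τ_mem := hι
            Q := sqrtScalarGL (n + 1) hι * Q₀
            frame := ?_
            definite := ?_
            𝔪 := 𝔪
            lattice := h𝔪 }, rfl, rfl, rfl, rfl⟩
  · rw [isSignatureFrame_iff, negI_smul_map_hermitianToSkew]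
    exact key
  · intro τ' hτ' hne
    rw [negI_smul_map_hermitianToSkew]
    exact (hpos τ' hτ' hne).smul ((zero_lt_negI_mul_iff K hstar τ').2 hτ')

/-- Entrywise complex conjugation on `GL_m(ℂ)`. -/
noncomputable def conjGL (m : ℕ) : GL (Fin m) ℂ →* GL (Fin m) ℂ :=
  Units.map (RingHom.mapMatrix (starRingEnd ℂ)).toMonoidHom

omit [NumberField K] [IsCMField K] in
/-- The matrix of `conjGL m Q` is the entrywise conjugate of the matrix of `Q`. -/
theorem coe_conjGL {m : ℕ} (Q : GL (Fin m) ℂ) :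
    ((conjGL m Q : GL (Fin m) ℂ) : Matrix (Fin m) (Fin m) ℂ) =
      (Q : Matrix (Fin m) (Fin m) ℂ).map (starRingEnd ℂ) := rfl

omit [NumberField K] [IsCMField K] in
/-- `(-i)(-T)^{τ̄}` is the entrywise complex conjugate of `(-i) T^τ`. -/
theorem negI_smul_map_neg_conjugate {m : ℕ} (T : Matrix (Fin m) (Fin m) K) (τ : K →+* ℂ) :
    (-Complex.I) • (-T).map (ComplexEmbedding.conjugate τ) =
      ((-Complex.I) • T.map τ).map (starRingEnd ℂ) := by
  ext i j
  simp only [Matrix.smul_apply, Matrix.map_apply, Matrix.neg_apply, ComplexEmbedding.conjugate_coe_eq,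
    map_neg, map_mul, Complex.conj_I, smul_eq_mul]
  ring

omit [NumberField K] [IsCMField K] in
/-- A hermitian matrix is its own conjugate-transpose: entrywise conjugation is transposition. -/
theorem map_conj_eq_transpose_of_isHermitian {m : ℕ} {H : Matrix (Fin m) (Fin m) ℂ}
    (hH : H.IsHermitian) : H.map (starRingEnd ℂ) = Hᵀ := by
  ext i j
  have := congrFun (congrFun hH.eq i) j
  rw [conjTranspose_apply] at this
  rw [Matrix.map_apply, transpose_apply, starRingEnd_apply, ← this, star_star]

omit [NumberField K] [IsCMField K] in
/-- `J_{r,s}` is real. -/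
theorem Jrs_map_conj (m r : ℕ) : (Jrs m r).map (starRingEnd ℂ) = Jrs m r := by
  unfold Jrs
  rw [diagonal_map (map_zero _)]
  congr 1
  ext i
  split_ifs <;> simp

omit [NumberField K] [IsCMField K] in
/-- Conjugating a signature frame: `H = Q̄ J ᵗQ` gives `H̄ = Q J ᵗQ̄`, i.e. `Q̄` is a frame for `H̄`. -/
theorem isSignatureFrameOf_map_conj {m : ℕ} {H : Matrix (Fin m) (Fin m) ℂ} {r : ℕ} {Q : GL (Fin m) ℂ}
    (hQ : IsSignatureFrameOf H r Q) :
    IsSignatureFrameOf (H.map (starRingEnd ℂ)) r (conjGL m Q) := by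
  unfold IsSignatureFrameOf at hQ ⊢
  rw [hQ, Matrix.map_mul, Matrix.map_mul, Jrs_map_conj, coe_conjGL, transpose_map]

/-- The conjugate datum: `T ↦ -T`, `Φ ↦ Φ̄`, `τ_1 ↦ τ̄_1`, `Q_1 ↦ Q̄_1`, same lattice.  It satisfies the
hypotheses of Theorem 8.1 with the distinguished embedding replaced by its complex conjugate; its ball quotient
is the complex-conjugate surface (`embedAt_conj`, `ballAction_map_conj` below). -/
noncomputable def Thm81Data.conj {r : ℕ} (D : Thm81Data K r) : Thm81Data K r where
  T := -D.T
  skew := by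
    have h := D.skew
    unfold IsSkewHermitian at h ⊢
    rw [conjTranspose_neg, h, neg_neg]
  Φ := conjCMType K D.Φ
  cmtype := by
    intro φ
    have h := D.cmtype φ
    simp only [conjCMType, Set.mem_setOf_eq, ComplexEmbedding.conjugate, star_star]
    exact h.symm
  τ := ComplexEmbedding.conjugate D.τ
  τ_mem := by
    simp only [conjCMType, Set.mem_setOf_eq, ComplexEmbedding.conjugate, star_star]
    exact D.τ_mem
  Q := conjGL (r + 1) D.Q
  frame := by
    have h := D.frame
    rw [isSignatureFrame_iff] at h ⊢
    rw [negI_smul_map_neg_conjugate]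
    exact isSignatureFrameOf_map_conj h
  definite := by
    intro τ' hτ' hne
    have hmem : ComplexEmbedding.conjugate τ' ∈ D.Φ := hτ'
    have hne' : ComplexEmbedding.conjugate τ' ≠ D.τ := by
      intro h
      apply hne
      rw [← h]
      exact (star_star τ').symm
    have hpd := D.definite _ hmem hne'
    have e := negI_smul_map_neg_conjugate K D.T (ComplexEmbedding.conjugate τ')
    rw [show ComplexEmbedding.conjugate (ComplexEmbedding.conjugate τ') = τ' from star_star τ'] at e
    rw [e, map_conj_eq_transpose_of_isHermitian hpd.1]
    exact hpd.transpose
  𝔪 := D.𝔪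
  lattice := D.lattice

omit [NumberField K] [IsCMField K] in
/-- The embedding (4.3) of the conjugate datum is the entrywise conjugate of the original one:
`Q̄⁻¹ α^{τ} Q̄ = conj (Q⁻¹ α^{τρ} Q)`. -/
theorem embedAt_conj {m : ℕ} (τ : K →+* ℂ) (Q : GL (Fin m) ℂ) (α : Matrix (Fin m) (Fin m) K) :
    embedAt K (ComplexEmbedding.conjugate τ) (conjGL m Q) α =
      (embedAt K τ Q α).map (starRingEnd ℂ) := by
  unfold embedAt
  rw [Matrix.map_mul, Matrix.map_mul, ← map_inv, coe_conjGL, coe_conjGL, Matrix.map_map]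
  congr 2

/-- The action of the conjugate matrix on the conjugate point is the conjugate of the action:
`β̄(z̄) = conj (β(z))`. -/
theorem ballAction_map_conj {r : ℕ} (β : Matrix (Fin (r + 1)) (Fin (r + 1)) ℂ) (z : Fin r → ℂ) :
    ballAction (β.map (starRingEnd ℂ)) (fun k => (starRingEnd ℂ) (z k)) =
      fun k => (starRingEnd ℂ) (ballAction β z k) := by
  ext k
  simp only [ballAction, Matrix.map_apply, map_div₀, map_add, map_sum, map_mul]

end DictionaryProof

end Summit.Ventures.HodgeRepro2
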